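import Summits.CriticalPhenomena.SAWScalingLimit.Theorems.SAWRenewalTightnessSubseqIdentificationTubeConcat
import Summits.CriticalPhenomena.SAWScalingLimit.Theorems.SAWRenewalTightnessSubseqIdentificationWienerTubePositive
import Literature.Probability.RandomPlanarGeometry.SLEBubblesThm65Kappa
import Literature.Probability.RandomPlanarGeometry.SLERestrictionAlive
import Literature.Probability.RandomPlanarGeometry.LoewnerSlidHullStar
import Literature.Probability.RandomPlanarGeometry.RestrictionHullsProofs
import Literature.Probability.RandomPlanarGeometry.RestrictionHullsRiemannProofs
import Mathlib.MeasureTheory.Integral.Prod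
import HarnessLib

/-!
# From the tube to essential unboundedness of the compensator (line `boundary-area-law`, L3c)

Crux `SubseqIdentification` (stmt-CriticalPhenomena-0783), lead c5, registered stub L3c
`stub_compensatorEssUnbounded_of_tube`: the deterministic tube statement (L3a ∧ L3b of the line)
implies L3 — for `0 < κ < 8/3`, `A ∈ 𝒬*` nonempty, `ε > 0`: `P[γ ∩ A = ∅ ∧ e^{−λ_κ L^A} < ε] > 0`.
Proof: the SLE_κ driver lies in the tube with positive probability (p154929); freeze the path at `S`
(`integral_mul_eq_integral_integral_concat`, simple Markov on `C([0,∞), ℝ)`): a fresh path glued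
after `S` keeps `A` alive as soon as its driver keeps the slid `*`-hull `B = A_S − W_S` alive
forever (`forall_disjoint_closedHull_concat_c5`, p159573), an event of probability
`≥ P[γ' ∩ B = ∅] ≥ Φ_B'(0)^{α_κ} > 0` ([LSW] Thm. 6.5 `thm65_printed`, `e^{−x} ≤ 1`); on
{tube} ∩ {alive forever}, `γ ∩ A = ∅` a.s. and `L^A ≥ ∫_{(0,S]} m ≥ q`, `e^{−λ_κ q} < ε`.
References: Lawler–Schramm–Werner (2003) Thm. 6.5; Revuz–Yor (1999) Ch. III Prop. (3.5);
Stroock–Varadhan (1972) §3. No named fact is used.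
-/

noncomputable section

open MeasureTheory Filter Topology Set Metric
open scoped NNReal ENNReal
open Literature.Probability.RandomPlanarGeometry
open Literature.Probability.RandomPlanarGeometry.PathOps
open Literature.Probability.Process (preWienerMeasure)
open UpperHalfPlane (upperHalfPlaneSet)

namespace Summit.CriticalPhenomena.SAWScalingLimit.Theorems.SubseqIdentification.BoundaryAreaLaw

open Loewner

section PathSets

/-! The path space `C([0, ∞), ℝ)` carries its Borel σ-algebra (instance arguments, as in
`BrownianPathFreezing`); the TUBE event is `{υ | ∀ s ≤ S, |drvK κ υ s − U s| ≤ η}` and the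
ALIVE-FOREVER event is `{υ | ∀ n : ℕ, closedHull (drvK κ υ) n ∩ A = ∅}`. -/

variable [MeasurableSpace C(ℝ≥0, ℝ)] [BorelSpace C(ℝ≥0, ℝ)] {κ : ℝ≥0}

omit [MeasurableSpace C(ℝ≥0, ℝ)] [BorelSpace C(ℝ≥0, ℝ)] in
/-- The tube event is closed in the compact-open topology (evaluations are continuous). -/
theorem isClosed_tubeSetC5 (U : ℝ≥0 → ℝ) (S : ℝ≥0) (η : ℝ) : IsClosed ({υ : C(ℝ≥0, ℝ) | ∀ s : ℝ≥0, s ≤ S → |drvK κ υ s - U s| ≤ η}) := by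
  have : {υ : C(ℝ≥0, ℝ) | ∀ s : ℝ≥0, s ≤ S → |drvK κ υ s - U s| ≤ η} =
      ⋂ s : {s : ℝ≥0 // s ≤ S}, {υ | |drvK κ υ s - U s| ≤ η} := by
    ext υ
    simp only [mem_setOf_eq, mem_iInter, Subtype.forall]
  rw [this]
  refine isClosed_iInter fun s ↦ ?_
  have hc : Continuous fun υ : C(ℝ≥0, ℝ) ↦ |drvK κ υ s - U s| := by
    refine (Continuous.sub ?_ continuous_const).abs
    exact continuous_const.mul ((continuous_eval_const (s : ℝ≥0)).sub
      (continuous_eval_const (0 : ℝ≥0)))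
  exact isClosed_le hc continuous_const

/-- The tube event is Borel measurable. -/
theorem measurableSet_tubeSetC5 (U : ℝ≥0 → ℝ) (S : ℝ≥0) (η : ℝ) :
    MeasurableSet ({υ : C(ℝ≥0, ℝ) | ∀ s : ℝ≥0, s ≤ S → |drvK κ υ s - U s| ≤ η}) :=
  (isClosed_tubeSetC5 U S η).measurableSet

omit [MeasurableSpace C(ℝ≥0, ℝ)] [BorelSpace C(ℝ≥0, ℝ)] in
/-- The stopped path is in the tube iff the path is. -/
theorem stop_mem_tubeSetC5_iff {U : ℝ≥0 → ℝ} {S : ℝ≥0} {η : ℝ} (υ : C(ℝ≥0, ℝ)) :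
    stop S υ ∈ {υ : C(ℝ≥0, ℝ) | ∀ s : ℝ≥0, s ≤ S → |drvK κ υ s - U s| ≤ η} ↔ υ ∈ {υ : C(ℝ≥0, ℝ) | ∀ s : ℝ≥0, s ≤ S → |drvK κ υ s - U s| ≤ η} := by
  simp only [mem_setOf_eq]
  refine forall_congr' fun s ↦ forall_congr' fun hs ↦ ?_
  rw [drvK_stop_of_le κ υ hs]

/-- The alive-forever event is measurable (each alive event is, `Loewner.measurableSet_disjoint_closedHull`). -/
theorem measurableSet_aliveSetC5 {A : Set ℂ} (hA : IsStarHull A) (hne : A.Nonempty) :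
    MeasurableSet ({υ : C(ℝ≥0, ℝ) | ∀ n : ℕ, Disjoint (closedHull (drvK κ υ) n) A}) := by
  have : {υ : C(ℝ≥0, ℝ) | ∀ n : ℕ, Disjoint (closedHull (drvK κ υ) n) A} =
      ⋂ n : ℕ, {υ : C(ℝ≥0, ℝ) | Disjoint (closedHull (drvK κ υ) n) A} := by
    ext υ; simp
  rw [this]
  exact MeasurableSet.iInter fun n ↦ measurableSet_disjoint_closedHull (W := fun υ : C(ℝ≥0, ℝ) ↦ drvK κ υ)
    (fun υ ↦ continuous_drvK κ υ) (fun υ ↦ drvK_zero κ υ) (fun s _ ↦ measurable_drvK_apply κ s) hA hne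

omit [MeasurableSpace C(ℝ≥0, ℝ)] [BorelSpace C(ℝ≥0, ℝ)] in
/-- Alive at every integer time means alive at every time (closed hulls increase). -/
theorem forall_disjoint_of_mem_aliveSetC5 {A : Set ℂ} {υ : C(ℝ≥0, ℝ)}
    (h : υ ∈ {υ : C(ℝ≥0, ℝ) | ∀ n : ℕ, Disjoint (closedHull (drvK κ υ) n) A}) (t : ℝ≥0) :
    Disjoint (closedHull (drvK κ υ) t) A :=
  (h ⌈(t : ℝ)⌉₊).mono_left (show closedHull (drvK κ υ) t ⊆ closedHull (drvK κ υ) (⌈(t : ℝ)⌉₊ : ℕ) from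
    fun _ hz ↦ ⟨hz.1, hz.2.trans (by
      rw [WithTop.coe_le_coe, ← NNReal.coe_le_coe]; push_cast; exact Nat.le_ceil _)⟩)

omit [MeasurableSpace C(ℝ≥0, ℝ)] [BorelSpace C(ℝ≥0, ℝ)] in
/-- `|1_s| ≤ 1`. -/
theorem abs_indicator_one_le_c5 {X : Type*} (s : Set X) (x : X) : |s.indicator (fun _ ↦ (1 : ℝ)) x| ≤ 1 := by
  by_cases hx : x ∈ s <;> simp [hx]

end PathSets

/-! ### Avoidance positivity for a `*`-hull ([LSW] Thm. 6.5 with `e^{−x} ≤ 1`) -/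

/-- **SLE_κ, `0 < κ ≤ 8/3`, avoids every `*`-hull with positive probability**:
`P[γ ∩ B = ∅] ≥ E[1{γ ∩ B = ∅} e^{−λ_κ L^B}] = Φ_B'(0)^{α_κ} > 0`. [cite: LawlerSchrammWerner2003Restriction, Thm. 6.5] -/
theorem measure_disjoint_range_sleTrace_pos_c5 {κ : ℝ≥0} (hκ0 : 0 < κ) (hκ : κ ≤ 8 / 3) {B : Set ℂ}
    (hB : IsStarHull B) : 0 < preWienerMeasure {ω | Disjoint (range (sleTrace κ ω)) B} := by
  obtain ⟨Φ, hΦ, -⟩ := IsStarHull.existsUnique_isRestrictionMap_holds hB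
  obtain ⟨d, hd0, -, hd⟩ := IsStarHull.exists_hasRestrictionDeriv_holds hB hΦ
  have h65 := thm65_printed hκ0 hκ hB hΦ hd
  have hpos : 0 < ENNReal.ofReal (d ^ sleBubbleExponent κ) := ENNReal.ofReal_pos.2 (Real.rpow_pos_of_pos hd0 _)
  rw [← h65] at hpos
  refine lt_of_lt_of_le hpos ?_
  refine (lintegral_indicator_le _ _).trans ?_
  calc ∫⁻ ω in {ω | Disjoint (range (sleTrace κ ω)) B}, poissonAvoidance (sleBubbleIntensity κ *
          ∫⁻ t, ENNReal.ofReal (starBubbleMass (slidHull (sleDriving κ ω) B t)) ∂timeMeasure) ∂preWienerMeasure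
      ≤ ∫⁻ _ in {ω | Disjoint (range (sleTrace κ ω)) B}, 1 ∂preWienerMeasure :=
        lintegral_mono fun ω ↦ poissonAvoidance_le_one _
    _ = preWienerMeasure {ω | Disjoint (range (sleTrace κ ω)) B} := setLIntegral_one _

/-- **Avoiding `B` forever implies the closed hulls never reach `B`, almost surely** (`κ ≤ 4`). -/
theorem ae_forall_disjoint_closedHull_of_disjoint_range_c5 {κ : ℝ≥0} (hκ0 : 0 < κ) (hκ4 : κ ≤ 4) {B : Set ℂ}
    (hB : IsStarHull B) :
    ∀ᵐ ω ∂preWienerMeasure, Disjoint (range (sleTrace κ ω)) B →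
      ∀ n : ℕ, Disjoint (closedHull (sleDriving κ ω) n) B := by
  filter_upwards [ae_disjoint_closedHull_iff_lt_firstHit hκ0 hκ4 hB] with ω hω hdisj n
  have h := (hω n).2
  rw [drvK_brownianCPath] at h
  apply h
  rw [firstHit_eq_top_iff_disjoint.2 hdisj]
  exact WithTop.coe_lt_top _

/-- **The fresh driver keeps a `*`-hull `B` alive forever with positive probability.** -/
theorem measure_forall_disjoint_closedHull_pos_c5 {κ : ℝ≥0} (hκ0 : 0 < κ) (hκ : κ ≤ 8 / 3) {B : Set ℂ}
    (hB : IsStarHull B) :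
    0 < preWienerMeasure {ω | ∀ n : ℕ, Disjoint (closedHull (sleDriving κ ω) n) B} := by
  have hκ4 : κ ≤ 4 := le_four_of_le_eight_thirds hκ
  refine lt_of_lt_of_le (measure_disjoint_range_sleTrace_pos_c5 hκ0 hκ hB) (measure_mono_ae ?_)
  filter_upwards [ae_forall_disjoint_closedHull_of_disjoint_range_c5 hκ0 hκ4 hB] with ω hω
  exact fun h ↦ hω h

/-- The event "the fresh driver keeps `B` alive at every integer time" is measurable. -/
theorem measurableSet_forall_disjoint_closedHull_c5 (κ : ℝ≥0) {B : Set ℂ} (hB : IsStarHull B) (hne : B.Nonempty) :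
    MeasurableSet {ω : ℝ≥0 → ℝ | ∀ n : ℕ, Disjoint (closedHull (sleDriving κ ω) n) B} := by
  have : {ω : ℝ≥0 → ℝ | ∀ n : ℕ, Disjoint (closedHull (sleDriving κ ω) n) B} =
      ⋂ n : ℕ, {ω | Disjoint (closedHull (sleDriving κ ω) n) B} := by
    ext ω; simp
  rw [this]
  exact MeasurableSet.iInter fun n ↦ measurableSet_disjoint_closedHull (W := fun ω ↦ sleDriving κ ω)
    (continuous_sleDriving κ) (sleDriving_zero κ) (fun s _ ↦ measurable_sleDriving κ s) hB hne

/-! ### The compensator on the tube event -/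

/-- On a path whose closed hulls miss `A` forever, the total compensator dominates the one on `(0, S]`. -/
theorem setLIntegral_Ioc_le_lintegral_timeMeasure_c5 {κ : ℝ≥0} {A : Set ℂ} (hA : IsStarHull A) (hne : A.Nonempty)
    {ω : ℝ≥0 → ℝ} (hall : ∀ t, Disjoint (closedHull (sleDriving κ ω) t) A) (S : ℝ≥0) :
    ∫⁻ s in Ioc (0 : ℝ) S, ENNReal.ofReal (starBubbleMass (slidHull (sleDriving κ ω) A s.toNNReal)) ≤
      ∫⁻ t, ENNReal.ofReal (starBubbleMass (slidHull (sleDriving κ ω) A t)) ∂timeMeasure := by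
  have hall' : ∀ t, Disjoint (closedHull (drvK κ (brownianCPath ω)) t) A := fun t ↦ by
    rw [drvK_brownianCPath]; exact hall t
  rw [lintegral_timeMeasure_eq_iSup_LpK hA hne hall']
  refine (le_of_eq ?_).trans (le_iSup (fun t ↦ LpK κ A t ω) S)
  refine setLIntegral_congr_fun measurableSet_Ioc fun x _ ↦ ?_
  rw [MpK, MFnK_of_alive (hall' _), drvK_brownianCPath]

/-- `e^{−λ_κ L} < ε` once `λ_κ q > −log ε` and `L ≥ q` (with `e^{−∞} = 0`). -/
theorem poissonAvoidance_lt_of_le_c5 {κ : ℝ≥0} (hκ0 : 0 < κ) (hκ : κ < 8 / 3) {ε q : ℝ} (hε : 0 < ε)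
    (hq : -Real.log ε < sleBubbleIntensityReal κ * q) {L : ℝ≥0∞} (hL : ENNReal.ofReal q ≤ L) :
    poissonAvoidance (sleBubbleIntensity κ * L) < ENNReal.ofReal ε := by
  have hlam := sleBubbleIntensityReal_pos hκ0 hκ
  by_cases htop : sleBubbleIntensity κ * L = ⊤
  · rw [htop, poissonAvoidance_top]
    exact ENNReal.ofReal_pos.2 hε
  · rw [poissonAvoidance_of_ne_top htop, ENNReal.ofReal_lt_ofReal_iff hε]
    have hLtop : L ≠ ⊤ := by
      intro h
      apply htop
      rw [h, ENNReal.mul_top]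
      simp [sleBubbleIntensity, hlam]
    have hqL : q ≤ L.toReal := (ENNReal.ofReal_le_iff_le_toReal hLtop).1 hL
    have hprod : (sleBubbleIntensity κ * L).toReal = sleBubbleIntensityReal κ * L.toReal := by
      rw [ENNReal.toReal_mul, sleBubbleIntensity, ENNReal.toReal_ofReal hlam.le]
    rw [hprod]
    calc Real.exp (-(sleBubbleIntensityReal κ * L.toReal)) ≤ Real.exp (-(sleBubbleIntensityReal κ * q)) := by
          apply Real.exp_le_exp.2
          have := mul_le_mul_of_nonneg_left hqL hlam.le
          linarith
      _ < ε := by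
          have h1 : Real.exp (-(sleBubbleIntensityReal κ * q)) < Real.exp (Real.log ε) :=
            Real.exp_lt_exp.2 (by linarith)
          rwa [Real.exp_log hε] at h1

/-! ### The stub -/

/-- **L3c — FROM THE TUBE TO ESSENTIAL UNBOUNDEDNESS OF THE COMPENSATOR (registered stub, line
`boundary-area-law`, lead c5).** If every nonempty `A ∈ 𝒬*` admits, for every level `q`, a tube of
continuous drivers keeping `A` alive at `S` with compensator `≥ q` on `(0, S]`, then for `0 < κ < 8/3`
and `ε > 0`: `P[γ ∩ A = ∅ ∧ e^{−λ_κ ∫₀^∞ m(A_t − W_t) dt} < ε] > 0` (tube positivity + simple Markov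
property + point cocycle + [LSW] Thm. 6.5). [cite: LawlerSchrammWerner2003Restriction, Thm. 6.5] -/
theorem stub_compensatorEssUnbounded_of_tube :
    (∀ (A : Set ℂ), IsStarHull A → A.Nonempty → ∀ q : ℝ,
      ∃ (U : ℝ≥0 → ℝ) (S : ℝ≥0) (η : ℝ), Continuous U ∧ U 0 = 0 ∧ 0 < η ∧
        ∀ (W : ℝ≥0 → ℝ), Continuous W → (∀ s : ℝ≥0, s ≤ S → |W s - U s| ≤ η) →
          (∀ z ∈ A, (S : WithTop ℝ≥0) < Loewner.swallowingTime W z) ∧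
          ENNReal.ofReal q ≤ ∫⁻ s in Set.Ioc (0 : ℝ) S,
            ENNReal.ofReal (starBubbleMass (Loewner.slidHull W A s.toNNReal))) →
    ∀ (κ : ℝ≥0), 0 < κ → κ < 8 / 3 → ∀ (A : Set ℂ), IsStarHull A → A.Nonempty →
      ∀ (ε : ℝ), 0 < ε →
        0 < preWienerMeasure {ω | Disjoint (range (sleTrace κ ω)) A ∧
            poissonAvoidance (sleBubbleIntensity κ *
              ∫⁻ t, ENNReal.ofReal (starBubbleMass (Loewner.slidHull (sleDriving κ ω) A t)) ∂timeMeasure) <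
              ENNReal.ofReal ε} := by
  intro htubeAll κ hκ0 hκ83 A hA hne ε hε
  letI : MeasurableSpace C(ℝ≥0, ℝ) := borel _
  haveI : BorelSpace C(ℝ≥0, ℝ) := ⟨rfl⟩
  haveI := isProbabilityMeasure_preWienerMeasure'
  have hκ83' : κ ≤ 8 / 3 := hκ83.le
  have hκ4 : κ ≤ 4 := le_four_of_le_eight_thirds hκ83'
  have hlam := sleBubbleIntensityReal_pos hκ0 hκ83
  -- the level `q` with `λ q > -log ε`
  set q : ℝ := -Real.log ε / sleBubbleIntensityReal κ + 1 with hq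
  have hqlog : -Real.log ε < sleBubbleIntensityReal κ * q := by
    rw [hq, mul_add, mul_div_cancel₀ _ hlam.ne', mul_one]
    linarith
  -- the tube data
  obtain ⟨U, S, η, hUc, hU0, hη, htube⟩ := htubeAll A hA hne q
  -- the two path events
  set T : Set (ℝ≥0 → ℝ) := {ω | brownianCPath ω ∈ {υ : C(ℝ≥0, ℝ) | ∀ s : ℝ≥0, s ≤ S → |drvK κ υ s - U s| ≤ η}} with hT
  set Al : Set (ℝ≥0 → ℝ) := {ω | brownianCPath ω ∈ {υ : C(ℝ≥0, ℝ) | ∀ n : ℕ, Disjoint (closedHull (drvK κ υ) n) A}} with hAl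
  have hTm : MeasurableSet T := measurable_brownianCPath (measurableSet_tubeSetC5 U S η)
  have hAlm : MeasurableSet Al := measurable_brownianCPath (measurableSet_aliveSetC5 hA hne)
  -- membership in `T` read on the SLE driver
  have hT_iff : ∀ ω, ω ∈ T ↔ ∀ s : ℝ≥0, s ≤ S → |sleDriving κ ω s - U s| ≤ η := fun ω ↦ by
    simp only [hT, mem_setOf_eq, drvK_brownianCPath]
  -- Step A: the tube has positive probability
  have hTpos : 0 < preWienerMeasure T := by
    refine lt_of_lt_of_le (measure_forall_abs_sleDriving_sub_lt_pos hκ0 S hη hUc.continuousOn hU0)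
      (measure_mono fun ω hω ↦ ?_)
    exact (hT_iff ω).2 fun s hs ↦ (hω s hs).le
  -- consequences of the tube for a sample path
  have hTalive : ∀ ω ∈ T, ∀ z ∈ A, (S : WithTop ℝ≥0) < swallowingTime (sleDriving κ ω) z := fun ω hω ↦
    (htube _ (continuous_sleDriving κ ω) ((hT_iff ω).1 hω)).1
  have hTmass : ∀ ω ∈ T, ENNReal.ofReal q ≤ ∫⁻ s in Ioc (0 : ℝ) S,
      ENNReal.ofReal (starBubbleMass (slidHull (sleDriving κ ω) A s.toNNReal)) := fun ω hω ↦
    (htube _ (continuous_sleDriving κ ω) ((hT_iff ω).1 hω)).2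
  have hTstar : ∀ ω ∈ T, IsStarHull (slidHull (sleDriving κ ω) A S) := fun ω hω ↦
    isStarHull_slidHull_of_disjoint (continuous_sleDriving κ ω) hA
      (disjoint_closedHull_of_forall_lt_c5 (hTalive ω hω))
  -- Step B: the freezing formula with `H = 1_tube`, `Φ = 1_alive`
  set H : C(ℝ≥0, ℝ) → ℝ := ({υ : C(ℝ≥0, ℝ) | ∀ s : ℝ≥0, s ≤ S → |drvK κ υ s - U s| ≤ η}).indicator fun _ ↦ (1 : ℝ) with hH
  set Φ : C(ℝ≥0, ℝ) → ℝ := ({υ : C(ℝ≥0, ℝ) | ∀ n : ℕ, Disjoint (closedHull (drvK κ υ) n) A}).indicator fun _ ↦ (1 : ℝ) with hΦ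
  have hHm : Measurable H := measurable_const.indicator (measurableSet_tubeSetC5 U S η)
  have hΦm : Measurable Φ := measurable_const.indicator (measurableSet_aliveSetC5 hA hne)
  have hfreeze := integral_mul_eq_integral_integral_concat S hHm hΦm
    (abs_indicator_one_le_c5 _) (abs_indicator_one_le_c5 _)
  -- the inner integral
  set g : (ℝ≥0 → ℝ) → ℝ := fun ω ↦ ∫ ω₂, Φ (concat S (stop S (brownianCPath ω), brownianCPath ω₂))
    ∂preWienerMeasure with hg
  have hHstop : ∀ ω, H (stop S (brownianCPath ω)) = T.indicator (fun _ ↦ (1 : ℝ)) ω := fun ω ↦ by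
    by_cases hω : ω ∈ T
    · rw [indicator_of_mem hω, hH, indicator_of_mem ((stop_mem_tubeSetC5_iff _).2 hω)]
    · rw [indicator_of_notMem hω, hH, indicator_of_notMem (fun h ↦ hω ((stop_mem_tubeSetC5_iff _).1 h))]
  -- LHS of the freezing formula = P(T ∩ Al)
  have hLHS : ∫ ω, H (stop S (brownianCPath ω)) * Φ (brownianCPath ω) ∂preWienerMeasure =
      preWienerMeasure.real (T ∩ Al) := by
    rw [← integral_indicator_one (hTm.inter hAlm)]
    refine integral_congr_ae (Eventually.of_forall fun ω ↦ ?_)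
    change H (stop S (brownianCPath ω)) * Φ (brownianCPath ω) = (T ∩ Al).indicator (fun _ ↦ (1 : ℝ)) ω
    rw [hHstop]
    have hΦω : Φ (brownianCPath ω) = Al.indicator (fun _ ↦ (1 : ℝ)) ω := by
      by_cases h2 : ω ∈ Al
      · rw [indicator_of_mem h2, hΦ, indicator_of_mem (show brownianCPath ω ∈ {υ : C(ℝ≥0, ℝ) | ∀ n : ℕ, Disjoint (closedHull (drvK κ υ) n) A} from h2)]
      · rw [indicator_of_notMem h2, hΦ, indicator_of_notMem (show brownianCPath ω ∉ {υ : C(ℝ≥0, ℝ) | ∀ n : ℕ, Disjoint (closedHull (drvK κ υ) n) A} from h2)]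
    rw [hΦω]
    by_cases h1 : ω ∈ T <;> by_cases h2 : ω ∈ Al <;>
      simp [indicator_of_mem, indicator_of_notMem, h1, h2, mem_inter_iff]
  -- joint measurability of the frozen functional, measurability of `g`
  have hFjoint : Measurable fun p : (ℝ≥0 → ℝ) × (ℝ≥0 → ℝ) ↦
      Φ (concat S (stop S (brownianCPath p.1), brownianCPath p.2)) :=
    hΦm.comp ((measurable_concat S).comp (((measurable_stop S).comp
      (measurable_brownianCPath.comp measurable_fst)).prodMk (measurable_brownianCPath.comp measurable_snd)))
  have hgm : StronglyMeasurable g :=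
    hFjoint.stronglyMeasurable.integral_prod_right' (ν := preWienerMeasure)
  have hg_nonneg : ∀ ω, 0 ≤ g ω := fun ω ↦ integral_nonneg fun ω₂ ↦ by
    simp only [hΦ]; exact indicator_nonneg (fun _ _ ↦ zero_le_one) _
  have hg_le : ∀ ω, g ω ≤ 1 := fun ω ↦ by
    refine (integral_mono_of_nonneg (Eventually.of_forall fun ω₂ ↦ ?_) (integrable_const (1 : ℝ))
      (Eventually.of_forall fun ω₂ ↦ ?_)).trans (by simp)
    · simp only [hΦ]; exact indicator_nonneg (fun _ _ ↦ zero_le_one) _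
    · simp only [hΦ]; exact indicator_le_self' (fun _ _ ↦ zero_le_one) _
  -- Step C: on the tube, the inner integral is positive
  have hg_pos : ∀ ω ∈ T, 0 < g ω := by
    intro ω hω
    set B := slidHull (sleDriving κ ω) A S with hB
    have hBstar : IsStarHull B := hTstar ω hω
    have hBne : B.Nonempty := hne.image _
    set G : Set (ℝ≥0 → ℝ) := {ω₂ | ∀ n : ℕ, Disjoint (closedHull (sleDriving κ ω₂) n) B} with hG
    have hGm : MeasurableSet G := measurableSet_forall_disjoint_closedHull_c5 κ hBstar hBne
    have hGpos : 0 < preWienerMeasure G := measure_forall_disjoint_closedHull_pos_c5 hκ0 hκ83' hBstar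
    -- on `G` the concatenated path is alive forever
    have hconc : ∀ ω₂ ∈ G, concat S (stop S (brownianCPath ω), brownianCPath ω₂) ∈ {υ : C(ℝ≥0, ℝ) | ∀ n : ℕ, Disjoint (closedHull (drvK κ υ) n) A} := by
      intro ω₂ hω₂ n
      refine forall_disjoint_closedHull_concat_c5 κ (fun W hW hWt ↦ (htube W hW hWt).1) ?_ ?_ n
      · intro s hs
        rw [drvK_brownianCPath]
        exact (hT_iff ω).1 hω s hs
      · intro u w hw
        rw [drvK_brownianCPath] at hw ⊢
        have hwim : 0 ≤ w.im := by
          have := hBstar.isBoundedHull.subset_closure hw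
          rw [show upperHalfPlaneSet = {z : ℂ | 0 < z.im} from rfl, Complex.closure_setOf_lt_im] at this
          exact this
        have hdisj := hω₂ ⌈(u : ℝ)⌉₊
        by_contra hle
        rw [not_lt] at hle
        refine Set.disjoint_left.1 hdisj ⟨hwim, hle.trans ?_⟩ hw
        rw [WithTop.coe_le_coe, ← NNReal.coe_le_coe]
        push_cast
        exact Nat.le_ceil _
    -- hence `g ω ≥ P(G) > 0`
    have hint : Integrable (fun ω₂ ↦ Φ (concat S (stop S (brownianCPath ω), brownianCPath ω₂))) preWienerMeasure := by
      refine (integrable_const (1 : ℝ)).mono' ?_ (Eventually.of_forall fun ω₂ ↦ ?_)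
      · exact (hFjoint.comp (measurable_const.prodMk measurable_id)).aestronglyMeasurable
      · rw [Real.norm_eq_abs]; exact abs_indicator_one_le_c5 _ _
    have hle : preWienerMeasure.real G ≤ g ω := by
      rw [← integral_indicator_one hGm]
      refine integral_mono_of_nonneg (Eventually.of_forall fun ω₂ ↦ indicator_nonneg (fun _ _ ↦ zero_le_one) _)
        hint (Eventually.of_forall fun ω₂ ↦ ?_)
      change G.indicator (fun _ ↦ (1 : ℝ)) ω₂ ≤ Φ (concat S (stop S (brownianCPath ω), brownianCPath ω₂))
      by_cases h : ω₂ ∈ G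
      · rw [indicator_of_mem h, hΦ, indicator_of_mem (hconc ω₂ h)]
      · rw [indicator_of_notMem h, hΦ]
        exact indicator_nonneg (fun _ _ ↦ zero_le_one) _
    have hGreal : 0 < preWienerMeasure.real G := by
      rw [measureReal_def]
      exact ENNReal.toReal_pos hGpos.ne' (measure_ne_top _ _)
    exact lt_of_lt_of_le hGreal hle
  -- Step D: the right-hand side of the freezing formula is positive, hence `P(T ∩ Al) > 0`
  have hF_int : Integrable (fun ω ↦ H (stop S (brownianCPath ω)) * g ω) preWienerMeasure := by
    refine (integrable_const (1 : ℝ)).mono' ?_ (Eventually.of_forall fun ω ↦ ?_)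
    · have h1 : Measurable fun ω ↦ H (stop S (brownianCPath ω)) :=
        hHm.comp ((measurable_stop S).comp measurable_brownianCPath)
      exact (h1.stronglyMeasurable.mul hgm).aestronglyMeasurable
    · rw [Real.norm_eq_abs, abs_mul]
      have h1 := abs_indicator_one_le_c5 ({υ : C(ℝ≥0, ℝ) | ∀ s : ℝ≥0, s ≤ S → |drvK κ υ s - U s| ≤ η}) (stop S (brownianCPath ω))
      have h2 : |g ω| ≤ 1 := by rw [abs_of_nonneg (hg_nonneg ω)]; exact hg_le ω
      have h3 : 0 ≤ |g ω| := abs_nonneg _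
      calc |H (stop S (brownianCPath ω))| * |g ω| ≤ 1 * 1 := by
            exact mul_le_mul h1 h2 h3 zero_le_one
        _ = 1 := one_mul 1
  have hF_nonneg : ∀ ω, 0 ≤ H (stop S (brownianCPath ω)) * g ω := fun ω ↦
    mul_nonneg (by rw [hHstop]; exact indicator_nonneg (fun _ _ ↦ zero_le_one) _) (hg_nonneg ω)
  have hRHSpos : 0 < ∫ ω, H (stop S (brownianCPath ω)) * g ω ∂preWienerMeasure := by
    by_contra hnot
    have h0 : ∫ ω, H (stop S (brownianCPath ω)) * g ω ∂preWienerMeasure = 0 :=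
      le_antisymm (not_lt.1 hnot) (integral_nonneg hF_nonneg)
    rw [integral_eq_zero_iff_of_nonneg (fun ω ↦ hF_nonneg ω) hF_int] at h0
    -- then `T` is null, contradicting Step A
    have hTnull : preWienerMeasure T = 0 := by
      refine measure_eq_zero_iff_ae_notMem.2 ?_
      filter_upwards [h0] with ω hω hωT
      have h1 : H (stop S (brownianCPath ω)) = 1 := by rw [hHstop, indicator_of_mem hωT]
      simp only [h1, one_mul, Pi.zero_apply] at hω
      exact (hg_pos ω hωT).ne' hω
    exact hTpos.ne' hTnull
  rw [hfreeze.symm.trans rfl] at hRHSpos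
  rw [hLHS] at hRHSpos
  have hTAlpos : 0 < preWienerMeasure (T ∩ Al) := by
    by_contra h
    have h0 : preWienerMeasure (T ∩ Al) = 0 := le_antisymm (not_lt.1 h) bot_le
    rw [measureReal_def, h0, ENNReal.toReal_zero] at hRHSpos
    exact lt_irrefl _ hRHSpos
  -- Step E: `T ∩ Al` is a.s. contained in the target event
  refine lt_of_lt_of_le hTAlpos (measure_mono_ae ?_)
  filter_upwards [ae_disjoint_closedHull_iff_lt_firstHit hκ0 hκ4 hA] with ω hω hωTA
  obtain ⟨hωT, hωAl⟩ := hωTA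
  have hall' : ∀ t, Disjoint (closedHull (drvK κ (brownianCPath ω)) t) A := fun t ↦
    forall_disjoint_of_mem_aliveSetC5 hωAl t
  have hall : ∀ t, Disjoint (closedHull (sleDriving κ ω) t) A := fun t ↦ by
    rw [← drvK_brownianCPath]; exact hall' t
  refine ⟨?_, ?_⟩
  · -- the trace avoids `A`
    rw [← firstHit_eq_top_iff_disjoint]
    by_contra hne'
    obtain ⟨t₀, ht₀⟩ := WithTop.ne_top_iff_exists.1 hne'
    have := (hω t₀).1 (hall' t₀)
    rw [← ht₀] at this
    exact lt_irrefl _ this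
  · -- the compensator is large
    exact poissonAvoidance_lt_of_le_c5 hκ0 hκ83 hε hqlog
      ((hTmass ω hωT).trans (setLIntegral_Ioc_le_lintegral_timeMeasure_c5 hA hne hall S))

end Summit.CriticalPhenomena.SAWScalingLimit.Theorems.SubseqIdentification.BoundaryAreaLaw

end
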